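import Summits.QuantumFields.YangMills.Theorems.FlatTubeReductionRateMarginsR
import Summits.QuantumFields.YangMills.Theorems.LuscherReductionTwistedTraceScalingBTProfileBudget
import HarnessLib

/-!
# SCHEDULE «R», part 3: the TAIL BUDGET of the dressed (B-T) brick — all eight hypotheses of `…DressedTauBudget.dressedTau_le` eventually, with `t = R = β^{-1/2}ℓ`, `α = β^{-1/2}ℓ²/(2L²)`,
# `R₁ = 5β^{-1/2}ℓ²`, `ε = β⁻¹`, `ρ = ε/3`, `P₀ = 13δ`, `κ₂ = β⁻¹`
# (route `FlatTubeReduction`, crux K1 `NearFlatRatioLaw` stmt-QuantumFields-24720; seat `ym-line-ftr-p1` g16; R2b1 RECORD rung — no summit statement is proved here)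

WHY (memo `Cruxes/NearFlatRatioLaw/Lines/ratepack-v5-nearpair-g16.md` §2).  At fibre radius `β^{-1/2}ℓ` the tail prefactor is `e^{M₀} ≤ e^{K·log²β}` (lane A's `eventually_btM0_le_B`), the
off-diagonal tail factor is `e^{3Bα²} = e^{3log⁴β/(4L)}`, and the defect floors of `…RateMarginsR` give `e^{−βm_nt} ≤ e^{−(9/4)log⁴β}`, `e^{−βm_far} ≤ e^{−log⁴β/(192L)}`; the
magnetic remainder `β·stepActionErr t σ ≤ 1` eventually.  Everything is then `exp(K'log²β − q·log⁴β) ≤ C(β⁻¹)^m` (lane A's `eventually_exp_logsq_sub_logpow4_le`) against the polynomial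
floors `budget_rhs_ge/ge'` of the right-hand sides.
* `eventually_beta_step_le_one_R`; ★★ `eventually_dressed_budget_R`.
HONEST FRAMING: real-analysis bookkeeping for a stub of the CONDITIONAL reduction route R2b1; femto rung R2b1 (RECORD label); not infinite volume, not a gap, not Clay.  No defs, no named
facts, no `sorry`.
-/

set_option autoImplicit false

noncomputable section

open MeasureTheory Filter Topology Real
open scoped BigOperators
open Literature.MathematicalPhysics.QuantumFieldTheory
open Literature.MathematicalPhysics.QuantumLattice

namespace Summit.QuantumFields.YangMills.Theorems.FemtoTransferGap.TwoLattice.ConstTube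

open Summit.QuantumFields.YangMills.Theorems.FemtoTransferGap
open Summit.QuantumFields.YangMills.Theorems.FemtoTransferGap.TwoLattice
open Summit.QuantumFields.YangMills.Theorems.FemtoTransferGap.TwoLattice.Avg
open Summit.QuantumFields.YangMills.Theorems.FemtoTransferGap.TwoLattice.Cov

variable {L : ℕ} [NeZero L]

/-! ## §1 The magnetic remainder at radius `β^{-1/2}ℓ` -/

/-- ★ Eventually `β·stepActionErr (ℓx) σ ≤ 1` at the rate window (`β(ℓx)² = ℓ²`: `N_pl(1728ℓ²√σ + 29376ℓ³x + 700569ℓ⁴x²) → 0`). [folklore] -/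
theorem eventually_beta_step_le_one_R {D : ℝ} (hD : 1 ≤ D) :
    ∀ᶠ β : ℝ in atTop, β * stepActionErr (L := L) (btLog β * powScale (1 / 2) β) ((L : ℝ) ^ 3 * (12 * (D * recordDelta1 L (1 / 6) β) ^ 4)) ≤ 1 := by
  have hNpl : (0 : ℝ) ≤ (Fintype.card (Plaquette 3 L) : ℝ) := Nat.cast_nonneg _
  -- the envelope `N_pl(1728·4L²·δ²ℓ² + (29376 + 700569)·xℓ⁴)` tends to `0`
  have hδt : Tendsto (fun β : ℝ => D * recordDelta1 L (1 / 6) β) atTop (𝓝 0) := by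
    simpa using (tendsto_recordDelta1 (L := L) (show (0 : ℝ) < 1 / 6 by norm_num)).const_mul D
  have t1 : Tendsto (fun β : ℝ => (D * recordDelta1 L (1 / 6) β) ^ 2 * btLog β ^ 2) atTop (𝓝 0) := by
    -- `δ²ℓ² = (14D/|Site|)²·β^{-1/3}ℓ²`
    have hN : (0 : ℝ) < (Fintype.card (Site 3 L) : ℝ) := by exact_mod_cast Fintype.card_pos
    have h := (tendsto_powScale_mul_btLog_pow (show (0 : ℝ) < 1 / 3 by norm_num) 2).const_mul ((14 * D / (Fintype.card (Site 3 L) : ℝ)) ^ 2)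
    rw [mul_zero] at h
    refine h.congr' ?_
    filter_upwards [eventually_ge_atTop (1 : ℝ)] with β hβ1
    have hβ0 : 0 ≤ β := by linarith
    have e16 : powScale (1 / 6) β ^ 2 = powScale (1 / 3) β := by
      rw [powScale_eq hβ1, powScale_eq hβ1, ← Real.rpow_mul_natCast hβ0]; norm_num
    unfold recordDelta1
    rw [show D * (14 * powScale (1 / 6) β / (Fintype.card (Site 3 L) : ℝ)) = (14 * D / (Fintype.card (Site 3 L) : ℝ)) * powScale (1 / 6) β by ring, mul_pow, e16]
    ring
  have t2 := tendsto_powScale_mul_btLog_pow (show (0 : ℝ) < 1 / 2 by norm_num) 4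
  have t : Tendsto (fun β : ℝ => (Fintype.card (Plaquette 3 L) : ℝ) * (1728 * (4 * (L : ℝ) ^ 2) * ((D * recordDelta1 L (1 / 6) β) ^ 2 * btLog β ^ 2) +
      (29376 + 700569) * (powScale (1 / 2) β * btLog β ^ 4))) atTop (𝓝 0) := by
    have := ((t1.const_mul (1728 * (4 * (L : ℝ) ^ 2))).add (t2.const_mul (29376 + 700569))).const_mul (Fintype.card (Plaquette 3 L) : ℝ)
    simpa using this
  filter_upwards [eventually_scheduleR_facts (L := L) hD, t.eventually (eventually_le_nhds one_pos)] with β h ht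
  obtain ⟨hβ1, -, hℓ1, hδ0, -, -, hx0, hx1, hβx, -, -, -, -, -, -, -, -, -, hsσ, -⟩ := h
  set x := powScale (1 / 2) β
  set δ := D * recordDelta1 L (1 / 6) β
  set ℓ := btLog β
  have hℓ0 : 0 ≤ ℓ := by linarith
  unfold stepActionErr
  have e : β * ((Fintype.card (Plaquette 3 L) : ℝ) * (1728 * (ℓ * x) ^ 2 * Real.sqrt ((L : ℝ) ^ 3 * (12 * δ ^ 4)) + 29376 * (ℓ * x) ^ 3 + 700569 * (ℓ * x) ^ 4)) =
      (Fintype.card (Plaquette 3 L) : ℝ) * (1728 * ℓ ^ 2 * Real.sqrt ((L : ℝ) ^ 3 * (12 * δ ^ 4)) + 29376 * ℓ ^ 3 * x + 700569 * ℓ ^ 4 * x ^ 2) * (β * x ^ 2) := by ring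
  rw [e, hβx, mul_one]
  have hx2 : x ^ 2 ≤ x := by nlinarith
  have hl34 : ℓ ^ 3 ≤ ℓ ^ 4 := pow_le_pow_right₀ hℓ1 (by norm_num)
  have a1 : 1728 * ℓ ^ 2 * Real.sqrt ((L : ℝ) ^ 3 * (12 * δ ^ 4)) ≤ 1728 * (4 * (L : ℝ) ^ 2) * (δ ^ 2 * ℓ ^ 2) := by nlinarith [hsσ, sq_nonneg ℓ]
  have a2 : 29376 * ℓ ^ 3 * x ≤ 29376 * (x * ℓ ^ 4) := by nlinarith [mul_le_mul_of_nonneg_left hl34 hx0.le]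
  have a3 : 700569 * ℓ ^ 4 * x ^ 2 ≤ 700569 * (x * ℓ ^ 4) := by nlinarith [mul_le_mul_of_nonneg_left hx2 (by positivity : (0 : ℝ) ≤ ℓ ^ 4)]
  calc (Fintype.card (Plaquette 3 L) : ℝ) * (1728 * ℓ ^ 2 * Real.sqrt ((L : ℝ) ^ 3 * (12 * δ ^ 4)) + 29376 * ℓ ^ 3 * x + 700569 * ℓ ^ 4 * x ^ 2)
      ≤ (Fintype.card (Plaquette 3 L) : ℝ) * (1728 * (4 * (L : ℝ) ^ 2) * (δ ^ 2 * ℓ ^ 2) + (29376 + 700569) * (x * ℓ ^ 4)) :=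
        mul_le_mul_of_nonneg_left (by linarith) hNpl
    _ ≤ 1 := ht

/-! ## §2 ★★ The budget of the dressed brick at schedule R, eventually -/

set_option maxHeartbeats 1600000 in
-- long real-arithmetic assembly with many opaque abbreviations (as in `…RateBudget.eventually_dressed_budget`)
/-- ★★ **ALL hypotheses of `…DressedTauBudget.dressedTau_le` eventually along schedule R**: `B ≥ 1`, `B ≥ 2/r⋆³`, `2ρ < R₁` (`ρ = btEps/3`), `(κ₂/12)ℓ(B) ≤ 1`, (H1), (H1'), (H2), (H3)
— with `κ₂ = β⁻¹`, `t = R = β^{-1/2}ℓ`, `δ = D·recordDelta1 L (1/6)`, `α = β^{-1/2}ℓ²/(2L²)`, `ε = btEps`, `R₁ = 5β^{-1/2}ℓ²`, `P₀ = 13δ`. [folklore] -/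
theorem eventually_dressed_budget_R {D : ℝ} (hD : 1 ≤ D) :
    ∀ᶠ β : ℝ in atTop, 1 ≤ (L : ℝ) ^ 3 * β ∧ 2 / rStar ^ 3 ≤ (L : ℝ) ^ 3 * β ∧ 2 * (btEps β / 3) < 5 * (powScale (1 / 2) β * btLog β ^ 2) ∧
      ((powScale 1 β) / 12 * (Real.exp (-3) * ((L : ℝ) ^ 3 * β) ^ (-(9 : ℝ) / 2) / 2000) ≤ 1) ∧
      (Real.exp (β * ((Fintype.card (Edge 3 L) : ℝ) * (2 * (btEps β / 3) + 2 * Real.sqrt 2 * (btLog β * powScale (1 / 2) β)) ^ 2) +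
            β * ((10 * Real.sqrt (Fintype.card (Plaquette 3 L × Fin 3)) * (btLog β * powScale (1 / 2) β)) ^ 2 + stepActionErr (L := L) (btLog β * powScale (1 / 2) β) 0)) *
          (Real.exp (3 * ((L : ℝ) ^ 3 * β) * (powScale (1 / 2) β * btLog β ^ 2 / (2 * (L : ℝ) ^ 2)) ^ 2) *
            Real.exp (-(β * btMnt L (D * recordDelta1 L (1 / 6) β) (powScale (1 / 2) β * btLog β ^ 2 / (2 * (L : ℝ) ^ 2)) (btLog β * powScale (1 / 2) β)
              (5 * (powScale (1 / 2) β * btLog β ^ 2)) (btEps β)) +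
              β * stepActionErr (L := L) (btLog β * powScale (1 / 2) β) ((L : ℝ) ^ 3 * (12 * (D * recordDelta1 L (1 / 6) β) ^ 4)))) ≤
        (powScale 1 β) / 12 * (gaugeMeasure L).real (gaugeCore L (btEps β / 3)) * (Real.exp (-3) * ((L : ℝ) ^ 3 * β) ^ (-(9 : ℝ) / 2) / 2000)) ∧
      (Real.exp (β * ((Fintype.card (Edge 3 L) : ℝ) * (2 * (btEps β / 3) + 2 * Real.sqrt 2 * (btLog β * powScale (1 / 2) β)) ^ 2) +
            β * ((10 * Real.sqrt (Fintype.card (Plaquette 3 L × Fin 3)) * (btLog β * powScale (1 / 2) β)) ^ 2 + stepActionErr (L := L) (btLog β * powScale (1 / 2) β) 0)) *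
          Real.exp (-(β * btMnt L (D * recordDelta1 L (1 / 6) β) (powScale (1 / 2) β * btLog β ^ 2 / (2 * (L : ℝ) ^ 2)) (btLog β * powScale (1 / 2) β)
            (5 * (powScale (1 / 2) β * btLog β ^ 2)) (btEps β)) +
            β * stepActionErr (L := L) (btLog β * powScale (1 / 2) β) ((L : ℝ) ^ 3 * (12 * (D * recordDelta1 L (1 / 6) β) ^ 4))) ≤
        (gaugeMeasure L).real (gaugeCore L (btEps β / 3)) * ((powScale 1 β) / 12 * (Real.exp (-3) * ((L : ℝ) ^ 3 * β) ^ (-(9 : ℝ) / 2) / 2000)) ^ 2) ∧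
      (Real.exp (β * ((Fintype.card (Edge 3 L) : ℝ) * (2 * (btEps β / 3) + 2 * Real.sqrt 2 * (btLog β * powScale (1 / 2) β)) ^ 2) +
            β * ((10 * Real.sqrt (Fintype.card (Plaquette 3 L × Fin 3)) * (btLog β * powScale (1 / 2) β)) ^ 2 + stepActionErr (L := L) (btLog β * powScale (1 / 2) β) 0)) *
          Real.exp (-(β * btMfar L (D * recordDelta1 L (1 / 6) β) (powScale (1 / 2) β * btLog β ^ 2 / (2 * (L : ℝ) ^ 2)) (btLog β * powScale (1 / 2) β) (btEps β)
            (13 * (D * recordDelta1 L (1 / 6) β)))) ≤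
        (powScale 1 β) / 12 * (gaugeMeasure L).real (gaugeCore L (btEps β / 3)) * (Real.exp (-3) * ((L : ℝ) ^ 3 * β) ^ (-(9 : ℝ) / 2) / 2000)) ∧
      (10 * Real.exp (-((L : ℝ) ^ 3 * β * (powScale (1 / 2) β * btLog β ^ 2 / (2 * (L : ℝ) ^ 2)) ^ 2)) ≤
        (powScale 1 β) / 12 * (Real.exp (-3) * ((L : ℝ) ^ 3 * β) ^ (-(9 : ℝ) / 2) / 2000)) := by
  have hL1 : (1 : ℝ) ≤ L := by exact_mod_cast NeZero.one_le
  have hL0 : (0 : ℝ) < L := by linarith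
  have hL3 : (1 : ℝ) ≤ (L : ℝ) ^ 3 := one_le_pow₀ hL1
  have hN0 : (0 : ℝ) < (Fintype.card (Site 3 L) : ℝ) := by exact_mod_cast Fintype.card_pos
  -- constants
  obtain ⟨K, hKdef⟩ : ∃ K : ℝ, K = 14 * Fintype.card (Edge 3 L) + 100 * Fintype.card (Plaquette 3 L × Fin 3) + 1 := ⟨_, rfl⟩
  obtain ⟨C₁, hC₁, hrhs⟩ := budget_rhs_ge (L := L)
  obtain ⟨C₃, hC₃def⟩ : ∃ C₃ : ℝ, C₃ = Real.exp (-3) * ((L : ℝ) ^ 3) ^ (-(9 : ℝ) / 2) / 6000 := ⟨_, rfl⟩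
  have hC₃ : 0 < C₃ := by
    have : 0 < ((L : ℝ) ^ 3) ^ (-(9 : ℝ) / 2) := Real.rpow_pos_of_pos (by positivity) _
    rw [hC₃def]; positivity
  -- the radius family `r = ℓx ≤ xℓ`
  have hr : ∀ β, 0 ≤ btLog β * powScale (1 / 2) β ∧ btLog β * powScale (1 / 2) β ≤ powScale (1 / 2) β * btLog β := fun β =>
    ⟨mul_nonneg (le_trans zero_le_one (one_le_btLog β)) (powScale_pos _ _).le, by rw [mul_comm]⟩
  have hq2 : (0 : ℝ) < 1 / (192 * L) := by positivity
  have hq4 : (0 : ℝ) < 1 / (4 * L) := by positivity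
  filter_upwards [eventually_budget_elementary (L := L), eventually_btM0_le_B (L := L) hr, eventually_scheduleR_facts (L := L) hD,
    eventually_btMnt_ge_R (L := L) hD, eventually_btMfar_ge_R (L := L) hD, eventually_beta_step_le_one_R (L := L) hD,
    eventually_exp_logsq_sub_logpow4_le (K := K + 1) (show (0 : ℝ) < 3 / 2 by norm_num) (show 0 < C₁ / 4 by positivity) (3 * Fintype.card (Site 3 L) + 6),
    eventually_exp_logsq_sub_logpow4_le (K := K + 1) (show (0 : ℝ) < 2 by norm_num) (show 0 < C₁ * C₃ / 16 by positivity) (3 * Fintype.card (Site 3 L) + 12),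
    eventually_exp_logsq_sub_logpow4_le (K := K) hq2 (show 0 < C₁ / 4 by positivity) (3 * Fintype.card (Site 3 L) + 6),
    eventually_exp_logsq_sub_logpow4_le (K := Real.log 10) hq4 (show 0 < C₃ / 4 by positivity) 6,
    eventually_ge_atTop (1 : ℝ)] with β hel hM hf hnt hfar hstep g1 g1' g2 g3 hβ1
  obtain ⟨hB1, hB2, hρR1⟩ := hel
  obtain ⟨-, hℓeq, hℓ1, -, -, -, hx0, -, hβx, -⟩ := hf
  have hβ0 : 0 < β := by linarith
  have hrhsβ := hrhs β hβ1
  have hrhs' := budget_rhs_ge' (L := L) hβ1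
  rw [← hC₃def] at hrhs'
  -- names
  obtain ⟨y, hy⟩ : ∃ y : ℝ, y = powScale 1 β := ⟨_, rfl⟩
  obtain ⟨lB, hlB⟩ : ∃ lB : ℝ, lB = Real.exp (-3) * ((L : ℝ) ^ 3 * β) ^ (-(9 : ℝ) / 2) / 2000 := ⟨_, rfl⟩
  obtain ⟨G, hGdef⟩ : ∃ G : ℝ, G = (gaugeMeasure L).real (gaugeCore L (btEps β / 3)) := ⟨_, rfl⟩
  rw [← hy] at g1 g1' g2 g3 hrhsβ hrhs' ⊢
  rw [← hlB] at hrhsβ hrhs' ⊢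
  rw [← hGdef] at hrhsβ ⊢
  rw [← hKdef] at hM
  have hy0 : 0 < y := by rw [hy]; exact powScale_pos _ _
  have hy1 : y ≤ 1 := by rw [hy]; exact powScale_le_one zero_le_one β
  have hG0 : 0 ≤ G := by rw [hGdef]; exact measureReal_nonneg
  have hlB0 : 0 < lB := by rw [hlB]; positivity
  have hlB1 : lB ≤ 1 / 2000 := by
    rw [hlB]
    have h1 : Real.exp (-3) ≤ 1 := Real.exp_le_one_iff.mpr (by norm_num)
    have h2 : ((L : ℝ) ^ 3 * β) ^ (-(9 : ℝ) / 2) ≤ 1 := Real.rpow_le_one_of_one_le_of_nonpos hB1 (by norm_num)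
    have h3 : 0 ≤ ((L : ℝ) ^ 3 * β) ^ (-(9 : ℝ) / 2) := Real.rpow_nonneg (by positivity) _
    have := mul_le_mul h1 h2 h3 zero_le_one
    linarith
  -- `ℓ ≥ 1`, `log²β ≥ 1`
  have hlog1 : 1 ≤ Real.log β := by rw [← hℓeq]; exact hℓ1
  have hlog2 : 1 ≤ Real.log β ^ 2 := one_le_pow₀ hlog1
  have hlog24 : Real.log β ^ 2 ≤ Real.log β ^ 4 := pow_le_pow_right₀ hlog1 (by norm_num)
  -- the threshold identities `Bα² = log⁴β/(4L)`
  have e1 : (L : ℝ) ^ 3 * β * (powScale (1 / 2) β * btLog β ^ 2 / (2 * (L : ℝ) ^ 2)) ^ 2 = 1 / (4 * L) * Real.log β ^ 4 := by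
    rw [← hℓeq]
    have e : (L : ℝ) ^ 3 * β * (powScale (1 / 2) β * btLog β ^ 2 / (2 * (L : ℝ) ^ 2)) ^ 2 = (L : ℝ) ^ 3 / (4 * (L : ℝ) ^ 4) * btLog β ^ 4 * (β * powScale (1 / 2) β ^ 2) := by
      field_simp; ring
    rw [e, hβx, mul_one]; field_simp
  have e3 : 3 * ((L : ℝ) ^ 3 * β) * (powScale (1 / 2) β * btLog β ^ 2 / (2 * (L : ℝ) ^ 2)) ^ 2 = 3 / (4 * L) * Real.log β ^ 4 := by
    calc 3 * ((L : ℝ) ^ 3 * β) * (powScale (1 / 2) β * btLog β ^ 2 / (2 * (L : ℝ) ^ 2)) ^ 2 = 3 * ((L : ℝ) ^ 3 * β * (powScale (1 / 2) β * btLog β ^ 2 / (2 * (L : ℝ) ^ 2)) ^ 2) := by ring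
      _ = _ := by rw [e1]; ring
  -- `2ρ < R₁`: `btR1 = 5xℓ ≤ 5xℓ²`
  have hρR : 2 * (btEps β / 3) < 5 * (powScale (1 / 2) β * btLog β ^ 2) := by
    have h : btR1 β ≤ 5 * (powScale (1 / 2) β * btLog β ^ 2) := by
      unfold btR1
      have := mul_le_mul_of_nonneg_left (le_self_pow₀ hℓ1 (by norm_num : (2 : ℕ) ≠ 0)) (by positivity : (0 : ℝ) ≤ 5 * powScale (1 / 2) β)
      linarith
    exact lt_of_lt_of_le hρR1 h
  -- the exponential pieces
  have aM : Real.exp (β * ((Fintype.card (Edge 3 L) : ℝ) * (2 * (btEps β / 3) + 2 * Real.sqrt 2 * (btLog β * powScale (1 / 2) β)) ^ 2) +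
      β * ((10 * Real.sqrt (Fintype.card (Plaquette 3 L × Fin 3)) * (btLog β * powScale (1 / 2) β)) ^ 2 + stepActionErr (L := L) (btLog β * powScale (1 / 2) β) 0)) ≤
      Real.exp (K * Real.log β ^ 2) := Real.exp_le_exp.mpr hM
  have aE₁ : Real.exp (-(β * btMnt L (D * recordDelta1 L (1 / 6) β) (powScale (1 / 2) β * btLog β ^ 2 / (2 * (L : ℝ) ^ 2)) (btLog β * powScale (1 / 2) β)
      (5 * (powScale (1 / 2) β * btLog β ^ 2)) (btEps β)) +
      β * stepActionErr (L := L) (btLog β * powScale (1 / 2) β) ((L : ℝ) ^ 3 * (12 * (D * recordDelta1 L (1 / 6) β) ^ 4))) ≤ Real.exp (1 - 9 / 4 * Real.log β ^ 4) :=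
    Real.exp_le_exp.mpr (by linarith)
  have aE₂ : Real.exp (-(β * btMfar L (D * recordDelta1 L (1 / 6) β) (powScale (1 / 2) β * btLog β ^ 2 / (2 * (L : ℝ) ^ 2)) (btLog β * powScale (1 / 2) β) (btEps β)
      (13 * (D * recordDelta1 L (1 / 6) β)))) ≤ Real.exp (-(1 / (192 * L) * Real.log β ^ 4)) := Real.exp_le_exp.mpr (by
    have : Real.log β ^ 4 / (192 * L) = 1 / (192 * L) * Real.log β ^ 4 := by ring
    linarith [this])
  have aE₃ : Real.exp (3 * ((L : ℝ) ^ 3 * β) * (powScale (1 / 2) β * btLog β ^ 2 / (2 * (L : ℝ) ^ 2)) ^ 2) = Real.exp (3 / (4 * L) * Real.log β ^ 4) := by rw [e3]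
  have hK0 : 0 < Real.exp (K * Real.log β ^ 2) := Real.exp_pos _
  have h34L : 3 / (4 * (L : ℝ)) ≤ 3 / 4 := div_le_div_of_nonneg_left (by norm_num) (by norm_num) (by linarith)
  have hl4 : 0 ≤ Real.log β ^ 4 := by positivity
  refine ⟨hB1, hB2, hρR, ?_, ?_, ?_, ?_, ?_⟩
  · -- `(y/12)·lB ≤ 1`
    nlinarith
  · -- (H1): exponent `K log² + 3/(4L) log⁴ + 1 − (9/4) log⁴ ≤ (K+1) log² − (3/2) log⁴`
    rw [aE₃]
    have hexp : K * Real.log β ^ 2 + (3 / (4 * L) * Real.log β ^ 4 + (1 - 9 / 4 * Real.log β ^ 4)) ≤ (K + 1) * Real.log β ^ 2 - 3 / 2 * Real.log β ^ 4 := by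
      have := mul_le_mul_of_nonneg_right h34L hl4
      nlinarith [hlog2]
    calc _ ≤ Real.exp (K * Real.log β ^ 2) * (Real.exp (3 / (4 * L) * Real.log β ^ 4) * Real.exp (1 - 9 / 4 * Real.log β ^ 4)) :=
          mul_le_mul aM (mul_le_mul_of_nonneg_left aE₁ (Real.exp_pos _).le) (by positivity) hK0.le
      _ = Real.exp (K * Real.log β ^ 2 + (3 / (4 * L) * Real.log β ^ 4 + (1 - 9 / 4 * Real.log β ^ 4))) := by rw [← Real.exp_add, ← Real.exp_add]
      _ ≤ Real.exp ((K + 1) * Real.log β ^ 2 - 3 / 2 * Real.log β ^ 4) := Real.exp_le_exp.mpr hexp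
      _ ≤ C₁ / 4 * y ^ (3 * Fintype.card (Site 3 L) + 6) := g1
      _ ≤ y / 12 * G * lB := by linarith [hrhsβ]
  · -- (H1')
    have hprod : C₁ * y ^ (3 * Fintype.card (Site 3 L) + 6) * (C₃ * y ^ 6) ≤ (y / 3 * G * lB) * (y / 3 * lB) :=
      mul_le_mul hrhsβ hrhs' (by positivity) (by positivity)
    have hexp : K * Real.log β ^ 2 + (1 - 9 / 4 * Real.log β ^ 4) ≤ (K + 1) * Real.log β ^ 2 - 2 * Real.log β ^ 4 := by nlinarith [hlog2]
    calc _ ≤ Real.exp (K * Real.log β ^ 2) * Real.exp (1 - 9 / 4 * Real.log β ^ 4) := mul_le_mul aM aE₁ (Real.exp_pos _).le hK0.le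
      _ = Real.exp (K * Real.log β ^ 2 + (1 - 9 / 4 * Real.log β ^ 4)) := by rw [← Real.exp_add]
      _ ≤ Real.exp ((K + 1) * Real.log β ^ 2 - 2 * Real.log β ^ 4) := Real.exp_le_exp.mpr hexp
      _ ≤ C₁ * C₃ / 16 * y ^ (3 * Fintype.card (Site 3 L) + 12) := g1'
      _ = C₁ * y ^ (3 * Fintype.card (Site 3 L) + 6) * (C₃ * y ^ 6) / 16 := by ring
      _ ≤ (y / 3 * G * lB) * (y / 3 * lB) / 16 := by linarith [hprod]
      _ = G * (y / 12 * lB) ^ 2 := by ring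
  · -- (H2)
    calc _ ≤ Real.exp (K * Real.log β ^ 2) * Real.exp (-(1 / (192 * L) * Real.log β ^ 4)) := mul_le_mul aM aE₂ (Real.exp_pos _).le hK0.le
      _ = Real.exp (K * Real.log β ^ 2 - 1 / (192 * L) * Real.log β ^ 4) := by rw [← Real.exp_add, ← sub_eq_add_neg]
      _ ≤ C₁ / 4 * y ^ (3 * Fintype.card (Site 3 L) + 6) := g2
      _ ≤ y / 12 * G * lB := by linarith [hrhsβ]
  · -- (H3)
    have hexp : Real.log 10 - 1 / (4 * L) * Real.log β ^ 4 ≤ Real.log 10 * Real.log β ^ 2 - 1 / (4 * L) * Real.log β ^ 4 := by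
      have h10 : 0 ≤ Real.log 10 := Real.log_nonneg (by norm_num)
      nlinarith [hlog2]
    calc 10 * Real.exp (-((L : ℝ) ^ 3 * β * (powScale (1 / 2) β * btLog β ^ 2 / (2 * (L : ℝ) ^ 2)) ^ 2))
        = Real.exp (Real.log 10 - 1 / (4 * L) * Real.log β ^ 4) := by
          rw [e1, ← Real.exp_log (by norm_num : (0 : ℝ) < 10), ← Real.exp_add, Real.log_exp, ← sub_eq_add_neg]
      _ ≤ Real.exp (Real.log 10 * Real.log β ^ 2 - 1 / (4 * L) * Real.log β ^ 4) := Real.exp_le_exp.mpr hexp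
      _ ≤ C₃ / 4 * y ^ 6 := g3
      _ ≤ y / 12 * lB := by linarith [hrhs']

end Summit.QuantumFields.YangMills.Theorems.FemtoTransferGap.TwoLattice.ConstTube

end
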